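import Summits.BirchSwinnertonDyer.Rank1Residual.X12.O11.RouteUTheoremU
import Summits.BirchSwinnertonDyer.Rank1Residual.X12.O11.RouteUSevenBinders
import Summits.BirchSwinnertonDyer.Rank1Residual.X12.JZeroThreeDescent
import Literature.NumberTheory.EllipticCurves.ModularityVersionApProofs
import Literature.NumberTheory.QuadraticFields.ImaginaryResiduePiForm
import HarnessLib

/-!
# K12r@3 — the «3-UNIT REGIME» of the `p = 3` slice: ROUTE U (Kriz–Li Thm. 1.20 ∧ Rem. 3.10 +
# Gross–Zagier–Kolyvagin + descent inputs) SPECIALISED to `p = 3`, `j = 0`, with the curve-generic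
# binders DISCHARGED (cell `bsd-print-cfram`, seat p4; PLAN §2 p4 (d), the candidate rank-4 split of
# stub `stub_jZeroRankOneBSDThree` of crux C1 `CMRamifiedThreeBSD`)

HONEST FRAMING (cell `bsd-print-cfram`, run/shared/lean/pub/bsd-print-cfram/, D-0131 (2) print
tier; verbatim in every file of the seat): the cell works the partition leaf
`CornerF ∧ p ramified in the CM field K` (LADDER-BSD row K7r = B13; W-ALL row 12r) in PARTITION
currency — a leaf or a cell counts only when its theorem is in the kernel BY NAME. NO class-wide
theorem for the `p = 3` slice is in print. bsd-cm's ROUTE U (`X12/O11/RouteUTheoremU.lean`,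
`RouteU.bsdp_of_thm120_of_rem310`, seat bsd-cm-ram) types, PRIME-GENERICALLY, the «unit case» at
an additive Eisenstein prime: `BSD(W, p)` from Kriz–Li 2019 Thm. 1.20 (`hKL`: the Bernoulli unit
condition makes `(|Ẽ^{ns}|/p)·log_ω P_K` a `p`-adic unit) ∧ Rem. 3.10 (`hRem`), Gross–Zagier with
the parametrisation constant, Kolyvagin, GZK, modularity, the rank-`0` twin's `p`-part and the
descent inputs (`p ∤ ∏ c_ℓ`, `p ∤ #Ш(W)`, `p ∤ #Ш(W^{(d_K)})`), all as displayed binders. THIS FILE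
is that theorem AT `p = 3` ON THE `j = 0` LEAF with every binder that holds for EVERY such curve
discharged in the kernel:
* `hp2` (`3 ≠ 2`);
* `hns` — `|Ẽ^{ns}(𝔽₃)| = 3`: a `j = 0` curve is ADDITIVE at `3` (`X12.addv_of_hasCM_of_cmRamified`,
  `JZeroThree.cmRamified_three_of_j_eq_zero`), so `a₃ = 0` (`LFunction_apply_eq_zero_of_hasAdditiveReductionAt`)
  and Kriz–Li's count is `3 + 0 − 0` (`lFunction_three_eq_zero_of_j_eq_zero`,
  `nsPointCount_three_of_j_eq_zero`);
* `h2` — no split multiplicative prime (CM: `RouteU.not_hasSplitMultiplicativeReductionAtPrime_of_hasCM`);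
* `hsplit` — `3` SPLITS in the Heegner field `K`: `3 ∣ N(W)` (bad at `3`,
  `dvd_conductorNorm_iff_not_hasGoodReductionAtPrime`) and the Heegner hypothesis for `N(W)`;
* `hμ` — `3 ∤ #μ(K)`: here `K` is the AUXILIARY Heegner field, not the CM field `ℚ(√−3)`; for
  `d_K < −4` one has `#μ(K) = 2` (`Quadratic.torsionOrder_eq_two_of_discr_lt_neg_four`). This is the
  point of the regime: Rubin's / BKNO's standing hypothesis `p ∤ #𝒪_K^×` fails for the CM field at
  `3`, but Kriz–Li's `K` is a Heegner field in which `3` splits, so `K ≠ ℚ(√−3)` and nothing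
  obstructs `p = 3` in ROUTE U. (The residual binder is `d_K < −4`, i.e. `K ≠ ℚ(i), ℚ(√−3)`;
  `K = ℚ(i)` is anyway excluded by `3` splitting.)
What REMAINS displayed (per class / per character, exactly as in ROUTE U): the Heegner data
`(K, D, H, ι, ιp, P)`, the twin `Wd ≅ W^{(d_K)}` with its rank-`0` `3`-part `htw` (for a CM twin this
is Burungale–Flach 2024, row C8 — supplied by the caller), `htam`/`hu`, the descent inputs `htamW`
(`3 ∤ ∏ c_ℓ` — FALSE on 381 of the 919 classes: the regime's boundary), `hSW`/`hSd` (the two-engine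
`3`-descent certificates of `X12/JZeroThreeRecords*.lean`), Kriz–Li's character data `(f, ψ, ω, ε_K)`
with the trace congruence `hss` (for `E_k`: `ψ = χ_k`, `E_k[3]^{ss} ≅ 𝔽₃(χ_k) ⊕ 𝔽₃(χ_k⁻¹ω)`),
(1) `h1a`/`h1b`, (3) `h3`, the Bernoulli unit condition `hB` (⟺ Kriz–Li's `3 ∤ h` conditions), and
T-U2's level-`0` generator data (`crd`, `g`, `hg0`, `hiv`). So this is a THEOREM SHAPE for the planner's
«3-unit regime» crux, not a closure: it upgrades, on the Kriz–Li-shaped classes, the record binder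
«`#Ш_an = q`, `ord₃ q = 0` (lane)» to PRINT (Kriz–Li Thm. 1.20 + Rem. 3.10 + GZ + the twin's BSD).
Nothing here is a Literature statement; no named fact is introduced; nothing is asserted about any
curve; beyond-print: NO (instantiation + elementary discharges).

References: `X12/O11/RouteUTheoremU.lean` (T-U5), `X12/O11/RouteUSevenBinders.lean` (the `p = 7`
discharges this file mirrors at `3`), `X12/JZeroThreeDescent.lean` §1; [cite: KrizLi2019, Thm. 1.20
(pp. 7–8), Rem. 1.17 (p. 6), Rem. 3.10 (p. 26), §10.3]; [cite: GrossZagier1986, V.§2];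
[cite: Oesterle1988Gauss, II §1 p. 53]; [cite: Miller2011LMS, Def. 1.1]; PLAN.md §2 p4 (d).
-/

set_option autoImplicit false

noncomputable section

open scoped Classical
open NumberField IsDedekindDomain IsDedekindDomain.HeightOneSpectrum Field WeierstrassCurve
open Literature.NumberTheory.EllipticCurves Literature.NumberTheory.EllipticCurves.ModularForms
  Literature.NumberTheory.EllipticCurves.Rank1Residual Literature.NumberTheory.QuadraticFields

namespace Summit.BirchSwinnertonDyer.Rank1Residual.X12.JZeroThree

/-! ## §1 The curve-generic binders of ROUTE U at `p = 3` on the `j = 0` leaf -/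

section Binders

variable (W : WeierstrassCurve ℚ) [W.IsElliptic]

/-- **`a₃(E) = 0` for a `j = 0` curve**: additive reduction at `3` (`X12.addv_of_hasCM_of_cmRamified`
with `cmRamified_three_of_j_eq_zero`) and `a_p = 0` at an additive prime
(`LFunction_apply_eq_zero_of_hasAdditiveReductionAt`). Mirror of
`RouteU.lFunction_seven_eq_zero_of_hasCM`. [cite: SilvermanAEC2009, VII.5 and §C.16 (a_p = 0 at additive p)] -/
theorem lFunction_three_eq_zero_of_j_eq_zero (hj : W.j = 0) : W.LFunction 3 = 0 := by
  haveI : Fact (Nat.Prime 3) := ⟨Nat.prime_three⟩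
  obtain ⟨hng, hnm⟩ := X12.addv_of_hasCM_of_cmRamified W 3 (W.hasCM_of_j_eq_zero hj) (by norm_num)
    (cmRamified_three_of_j_eq_zero W hj)
  set v : HeightOneSpectrum (𝓞 ℚ) :=
    (Rat.HeightOneSpectrum.primesEquiv (R := 𝓞 ℚ)).symm ⟨3, Nat.prime_three⟩ with hvdef
  have hv3 : (Rat.HeightOneSpectrum.primesEquiv v : ℕ) = 3 := by rw [hvdef, Equiv.apply_symm_apply]
  have hng' : ¬ W.HasGoodReductionAt v :=
    fun h => hng ((hasGoodReductionAtPrime_primesEquiv_iff_holds W v 3 hv3).mpr h)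
  have hnm' : ¬ W.HasMultiplicativeReductionAt v :=
    fun h => hnm ((hasMultiplicativeReductionAtPrime_primesEquiv_iff_holds W v 3 hv3).mpr h)
  have hadd : W.HasAdditiveReductionAt v := by
    rcases hasGoodReductionAt_or_hasMultiplicativeReductionAt_or_hasAdditiveReductionAt v W with
      h | h | h
    · exact absurd h hng'
    · exact absurd h hnm'
    · exact h
  exact W.LFunction_apply_eq_zero_of_hasAdditiveReductionAt hv3 hadd (dvd_refl 3)

/-- **`hns` at `3`: `|Ẽ^{ns}(𝔽₃)| = 3` for a globally minimal `j = 0` curve** (Kriz–Li's count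
`3 + [good] − a₃ = 3 + 0 − 0`). [cite: KrizLi2019, Rem. 1.17 (p. 6) (|Ẽ^{ns}(𝔽_p)| at an additive prime)] -/
theorem nsPointCount_three_of_j_eq_zero [W.IsGloballyMinimal] (hj : W.j = 0) :
    KrizLi2019.nsPointCount W 3 = 3 :=
  haveI : Fact (Nat.Prime 3) := ⟨Nat.prime_three⟩
  O11.RouteU.nsPointCount_eq_of_lFunction_eq_zero W 3 (not_good_three_of_j_eq_zero W hj)
    (lFunction_three_eq_zero_of_j_eq_zero W hj)

/-- **`hsplit` at `3`: `3` splits in every Heegner field of a `j = 0` curve** — `3 ∣ N(W)` (bad at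
`3`, `dvd_conductorNorm_iff_not_hasGoodReductionAtPrime`) and the Heegner hypothesis says every
prime of the level splits. [cite: GrossZagier1986, I.§3 (Heegner hypothesis)] -/
theorem ncard_primesOver_three_of_heegner (hj : W.j = 0) {K : Type} [Field K] [NumberField K]
    (hHN : SatisfiesHeegnerHypothesis (W.conductorNorm ℤ) K) :
    ((Ideal.span {((3 : ℕ) : ℤ)}).primesOver (𝓞 K)).ncard = 2 :=
  haveI : Fact (Nat.Prime 3) := ⟨Nat.prime_three⟩
  hHN 3 Nat.prime_three
    ((W.dvd_conductorNorm_iff_not_hasGoodReductionAtPrime 3).mpr (not_good_three_of_j_eq_zero W hj))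

omit [W.IsElliptic] in
/-- **`hμ` at `3`: `3 ∤ #μ(K)` for an imaginary quadratic `K` with `d_K < −4`** (`#μ(K) = 2`,
Oesterlé II §1; tree `Quadratic.torsionOrder_eq_two_of_discr_lt_neg_four`). [cite: Oesterle1988Gauss, II §1 p. 53] -/
theorem not_three_dvd_torsionOrder {K : Type} [Field K] [NumberField K] (hK : IsImaginaryQuadratic K)
    (hd4 : NumberField.discr K < -4) : ¬ 3 ∣ Units.torsionOrder K := by
  rw [Quadratic.torsionOrder_eq_two_of_discr_lt_neg_four hK.1 hd4]
  norm_num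

end Binders

/-! ## §2 ROUTE U at `p = 3` on the `j = 0` leaf (the «3-unit regime» shape) -/

/-- **BSD(W, 3) for a `j = 0` curve of analytic rank one in the 3-UNIT REGIME** — ROUTE U's
`RouteU.bsdp_of_thm120_of_rem310` at `p = 3` with the curve-generic binders (`hp2`, `hns`, `h2`,
`hsplit`, `hμ`) discharged by §1 (`hμ` reduced to `d_K < −4`). Every remaining binder is displayed
verbatim from T-U5: the named facts `hKL` (Kriz–Li Thm. 1.20) and `hRem` (Rem. 3.10); the Heegner
data and Gross–Zagier / Kolyvagin / GZK / modularity; the rank-`0` twin `Wd` with its `3`-part `htw`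
(Burungale–Flach for a CM twin — the caller's); the descent inputs `htamW` (`3 ∤ ∏ c_ℓ`), `hSW`,
`hSd` (`3 ∤ #Ш`: the two-engine certificates); Kriz–Li's character data with (1), (3) and the
Bernoulli unit condition `hB`; T-U2's level-`0` generator `g` with unit logarithm `hg0` and no
`3`-torsion over `K` (`hiv`). PER CLASS in its binders; a THEOREM SHAPE for the planner's
«3-unit regime» split of `stub_jZeroRankOneBSDThree`, NOT a closure of it.
[cite: KrizLi2019, Thm. 1.20 (pp. 7–8), Rem. 1.21 (p. 8), Rem. 3.10 (p. 26), §10.3]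
[cite: GrossZagier1986, V.§2 (pp. 310–312)] [cite: Miller2011LMS, Def. 1.1] -/
theorem bsdp_three_of_thm120_unitRegime
    (hKL : KrizLi2019.thm120_padicLogHeegner_unit_of_bernoulli)
    (hRem : KrizLi2019.rem310_padicLogHeegner_integral)
    (W : WeierstrassCurve ℚ) [W.IsElliptic] [W.IsGloballyMinimal] (hj : W.j = 0)
    [NeZero (W.conductorNorm ℤ)] (K : Type) [Field K] [NumberField K]
    [NeZero (NumberField.discr K).natAbs]
    (D : ModularParametrizationData W (W.conductorNorm ℤ))
    (H : HeegnerDatum (W.conductorNorm ℤ) (NumberField.discr K)) (ι : K →+* ℂ) (ιp : K →+* ℚ_[3])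
    (P : (W.baseChange K).toAffine.Point)
    -- T-U0's displayed inputs
    (hGZ : gross_zagier (W.conductorNorm ℤ) W K) (hKo : kolyvagin (W.conductorNorm ℤ) W K)
    (hGZK : rank_eq_analyticRank_of_analyticRank_le_one) (hmod : hasEntireLFunction_rat)
    (hK : IsImaginaryQuadratic K) (hd4 : NumberField.discr K < -4)
    (hHN : SatisfiesHeegnerHypothesis (W.conductorNorm ℤ) K)
    (hP : WeierstrassCurve.Affine.Point.map ι.toRatAlgHom P = heegnerPointComplex D H)
    (hr : W.analyticRank = 1)
    (hLt : (W.quadraticTwist (NumberField.discr K : ℚ)).entireLFunction 1 ≠ 0)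
    (Wd : WeierstrassCurve ℚ) [Wd.IsElliptic] [Wd.IsGloballyMinimal] (Cd : VariableChange ℚ)
    (hWd : Cd • W.quadraticTwist (NumberField.discr K : ℚ) = Wd)
    (htw : ∃ q : ℚ, Wd.entireLFunction 1 / (Wd.realPeriodRat : ℂ) = (q : ℂ) ∧
      padicValRat 3 q = (padicValNat 3 Wd.shaOrder : ℤ) + padicValNat 3 Wd.tamagawaProduct -
        2 * padicValNat 3 Wd.torsionOrder)
    (htam : padicValNat 3 Wd.tamagawaProduct = padicValNat 3 W.tamagawaProduct)
    (hu : padicValRat 3 (Cd.u : ℚ) = 0)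
    (htamW : ¬ 3 ∣ W.tamagawaProduct)
    (hSW : ∀ [Finite W.sha], ¬ 3 ∣ W.shaOrder) (hSd : ∀ [Finite Wd.sha], ¬ 3 ∣ Wd.shaOrder)
    -- Thm. 1.20's displayed inputs
    (f : ℕ) [NeZero f] (ψ : DirichletCharacter ℚ_[3] f) (ω : DirichletCharacter ℚ_[3] 3)
    (hψ : ψ.IsPrimitive) (hω : KrizLi2019.IsTeichmullerCharacter ω)
    (hss : ∀ ℓ : ℕ, ℓ.Prime → ¬ (ℓ ∣ 3 * W.conductorNorm ℤ) →
      ‖((W.LFunction ℓ : ℤ) : ℚ_[3]) - (ψ (ℓ : ZMod f) + ψ⁻¹ (ℓ : ZMod f) * ω (ℓ : ZMod 3))‖ < 1)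
    (h1a : ψ (3 : ZMod f) ≠ 1) (h1b : KrizLi2019.primVal (KrizLi2019.invMulOmega ψ ω) 3 ≠ 1)
    (h3 : ∀ ℓ : ℕ, (hℓ : ℓ.Prime) → ℓ ≠ 3 →
      (haveI := Fact.mk hℓ;
        ¬ W.HasGoodReductionAtPrime ℓ ∧ ¬ W.HasMultiplicativeReductionAtPrime ℓ) →
      ψ (ℓ : ZMod f) ≠ 1 ∧ KrizLi2019.primVal (KrizLi2019.invMulOmega ψ ω) ℓ ≠ 1)
    (εK : DirichletCharacter ℚ_[3] (NumberField.discr K).natAbs)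
    (hεK : KrizLi2019.IsKroneckerCharacterOf K εK)
    (hB : ¬ (‖KrizLi2019.bernoulliOnePrim (KrizLi2019.bernoulliCharOne ψ εK) *
        KrizLi2019.bernoulliOnePrim (KrizLi2019.bernoulliCharTwo ψ εK ω)‖ ≤ ((3 : ℕ) : ℝ)⁻¹))
    -- T-U2's displayed inputs
    [Finite (AddCommGroup.torsion (W.baseChange K).toAffine.Point)]
    (crd : (W.baseChange K).toAffine.Point →+ ℤ) (g : (W.baseChange K).toAffine.Point)
    (hg : crd g = 1) (hker : ∀ x, crd x = 0 → IsOfFinAddOrder x)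
    (hiv : ∀ x : (W.baseChange K).toAffine.Point, 3 • x = 0 → x = 0)
    (hg0 : ‖Castella2018.padicLogOmega W 3 ιp g‖ = 1) :
    BSDp W 3 :=
  haveI : Fact (Nat.Prime 3) := ⟨Nat.prime_three⟩
  O11.RouteU.bsdp_of_thm120_of_rem310 hKL hRem W 3 K D H ι ιp P hGZ hKo hGZK hmod hK hHN hP
    (by norm_num) (not_three_dvd_torsionOrder hK hd4) hr hLt Wd Cd hWd htw htam hu htamW hSW hSd
    f ψ ω hψ hω hss h1a h1b
    (O11.RouteU.not_hasSplitMultiplicativeReductionAtPrime_of_hasCM W (W.hasCM_of_j_eq_zero hj)) h3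
    (ncard_primesOver_three_of_heegner W hj hHN) εK hεK hB (nsPointCount_three_of_j_eq_zero W hj)
    crd g hg hker hiv hg0

end Summit.BirchSwinnertonDyer.Rank1Residual.X12.JZeroThree

end
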